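import Literature.MathematicalPhysics.QuantumFieldTheory.Balaban1983to89.B9QstarLettersAtPinsL2
import Literature.MathematicalPhysics.QuantumFieldTheory.Balaban1983to89.B9QLettersAtPins

/-!
# `Balaban1983to89.B9QLettersAtPinsL2` — THE BLOCK-L² LETTER `Letters313L2PZ.q` OF `Q(U)` AT THE PINS, EVERY REGULAR `U`, by transposition from the `Q*`-letter

T. Bałaban, *Propagators for lattice gauge theories in a background field*, Commun. Math. Phys. **99** (1985) 389–434
[`Balaban1985BackgroundPropagators`, "B9"]; [4] = T. Bałaban, *Propagators and renormalization transformations for lattice gauge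
theories. II*, Commun. Math. Phys. **96** (1984) 223–250 [`Balaban1984PropagatorsII`]; [3] = part I, Commun. Math. Phys. **95** (1984) 17–40
[`Balaban1984PropagatorsI`].

statement-level skeleton of published theorems with citation tags; proofs where landed; nothing here is a claim about the Yang–Mills
mass gap

THE PRINTED LOCI.  [B9] (3.12)–(3.14) p. 393 and (3.13) (*"Q\* the adjoint of Q"*), (3.110) p. 417, (3.46) p. 398 (block-L² classes), p. 398 (remark after (3.47)),
Thm 3.13 p. 426 (the letter Q); [3] (1.18) p. 20; [4] Lemma 2.1 (2.60) p. 234.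

THE POINT (cell `pub-ymgap`, node N06; width seat w5, CLAIM-2, sequel of `B9QLettersAtPins`).  `Q*` is the adjoint of `Q` for the dot products at an `SU(N)`-valued
configuration (`B9QLettersAtPins.dotProduct_QcoKH_eq`, from def-Y's `isTransposePair_QcoKH_QscoKH`), so n06-k's `B9SectDL2Decay.blockBd_of_adjoint` TRANSPOSES the
block-L² letters of `Q*` (`B9QstarLettersAtPinsL2.blockBd_Qstar_pins ∕ _len`) into those of `Q`: ★★ `blockBd_Q_pins` (`√(n_y⁻¹)·e^{δ(ℓ+4)}·e^{−δd}`, every `δ ≥ 0`) and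
★★ `blockBd_Q_pins_len` = the displayed field `Letters313L2PZ.q`'s shape `B₄·(vZ y·Lʲη·(L^{j′}η)⁻¹)·e^{−δd}` with `vZ := √(n⁻¹)`, `B₄ := L·e^{(δ+ε)(ℓ+4)}`, above the
(2.60) threshold `log L ≤ ε(2L² − 1)M` — at `QcoKH x.toKIdx (trBasis N) (bg9Y …) (fun U => U) (parBY x.toKIdx) U` (the pin `hQco12`), every member, every regular `U`.

HONEST SCOPE.  Ten lines of transposition bookkeeping over landed modules; nothing of [B9]'s propagator estimates asserted; COUNT-NEUTRAL; N06 is NOT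
discharged; one finite lattice at a time; nothing continuum, nothing about the mass gap ∕ Clay.  Cell `pub-ymgap` (HUMAN RULING D-0062 ∕ D-0154), Track A node
N06 [B9], width seat `pub-ymgap-dag-n06-w5` (g0), 2026-08-28.
-/

noncomputable section

namespace Literature.MathematicalPhysics.QuantumFieldTheory.Balaban1983to89.B9QLettersAtPinsL2

open B6Geom246MultiLevelTorus (geomT)
open B6GlobalChartV1 (PV blkV1)
open B6Ineq2142KLevelV1 (lvl β)
open B9GeoNormsKLevelV1 (geo9K)
open B9GeoLemma21KLevelV1 (geo9K_dist_comm geo9K_len_pos geo9K_one_le_L)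
open B9Thm34Ext (toB6)
open B9SectDL2Decay (BlockBd)
open B9CoReadingCoords (XBK blkBK)
open B9CoReadingCoordsH (XHK blkHK)
open B9QstarLettersAtPinsL2 (blockBd_Qstar_pins blockBd_Qstar_pins_len)
open B9QLettersAtPins (dotProduct_QcoKH_eq)
open Node00 Node00.OpsYSectDCoords
open scoped Matrix

variable {d ℓ : ℕ} {hd : 1 ≤ d + 1} {hL : Odd (ℓ + 1) ∧ 1 < ℓ + 1} {b₀ b₁ : ℝ}

section Members

open scoped Matrix.Norms.L2Operator
open B7Prop2SpecialUnitary (specialUnitaryUnits)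
open B9PinMembersKLevelV1 (MemberY geo9Y bg9Y)
open B9CoReadingCoordsTranspose (TrIdx trBasis)

variable {Mstar : ℕ} {N : ℕ} [NeZero N]
variable [∀ x : MemberY d ℓ hd hL b₀ b₁ Mstar, Fintype (geo9Y x).Site]

/-- ★★ **THE BLOCK-L² LETTER OF `Q(U)` AT THE PINS, EVERY MEMBER, EVERY REGULAR `U`** — by transposition from the `Q*`-letter (`blockBd_Qstar_pins`, n06-k
`blockBd_of_adjoint`): `‖1_{Δ(y)}Q(U)F‖₂ ≤ √(n_y⁻¹)·e^{δ(ℓ+4)}·e^{−δd(y,y′)}·‖1_{Δ(y′)}F‖₂`, every `δ ≥ 0`.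
[cite: Balaban1985BackgroundPropagators, (3.12)–(3.14) p.393, (3.13) («Q* the adjoint of Q»), (3.110) p.417, (3.46) p.398, Thm 3.13 p.426; Balaban1984PropagatorsI, (1.18) p.20] -/
theorem blockBd_Q_pins (x : MemberY d ℓ hd hL b₀ b₁ Mstar) {bI : FBondY x.toKIdx → IBondY x.toKIdx}
    (hβ1 : ∀ f : FBondY x.toKIdx, (geomT x.D).dist (β x.hN x.D x.hk (bI f)) (blkV1 x.hN x.D f) ≤ 1) {c α₀ : ℝ}
    {U : (bg9Y (Matrix (Fin N) (Fin N) ℂ) (specialUnitaryUnits (Fin N)) x).Cfg}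
    (hU : (bg9Y (Matrix (Fin N) (Fin N) ℂ) (specialUnitaryUnits (Fin N)) x).Reg335 c α₀ U)
    {δ : ℝ} (hδ : 0 ≤ δ) (R₀ : ℝ) (H₀ : Prop) :
    BlockBd (g := toB6 (geo9Y x) R₀ H₀) (blkBK x.toKIdx bI) (blkHK x.toKIdx)
      (QcoKH x.toKIdx (trBasis N) (bg9Y (Matrix (Fin N) (Fin N) ℂ) (specialUnitaryUnits (Fin N)) x) (fun U => U) (parBY x.toKIdx) U)
      (fun y y' => Real.sqrt (((((ℓ + 1 : ℕ) : ℝ) ^ (d + 1)) ^ lvl x.hN x.D x.hk y)⁻¹) *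
        (Real.exp (δ * ((ℓ : ℝ) + 4)) * Real.exp (-(δ * (geo9Y x).dist y y')))) := by
  have hadj := B9SectDL2Decay.blockBd_of_adjoint (g := toB6 (geo9Y x) R₀ H₀) (blk₁ := blkBK x.toKIdx bI) (blk₂ := blkHK x.toKIdx)
    (fun u F => dotProduct_QcoKH_eq x hU u F) (blockBd_Qstar_pins x hβ1 hU hδ R₀ H₀)
    (fun y y' => mul_nonneg (Real.sqrt_nonneg _) (mul_nonneg (Real.exp_nonneg _) (Real.exp_nonneg _)))
  refine hadj.mono fun y y' => le_of_eq ?_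
  change (geo9K x.toKIdx).Site at y y'
  simp only [geo9Y]
  rw [geo9K_dist_comm]

/-- ★★ **THE BLOCK-L² LETTER `Letters313L2PZ.q` AT THE PINS** (length-ratio form, `vZ := √(n⁻¹)`, `B₄ := L·e^{(δ+ε)(ℓ+4)}`): above the (2.60) threshold
`log L ≤ ε(2L² − 1)M`, `‖1_{Δ(y)}Q(U)F‖₂ ≤ B₄·(√(n_y⁻¹)·Lʲη·(L^{j′}η)⁻¹)·e^{−δd(y,y′)}·‖1_{Δ(y′)}F‖₂` — transposed from `blockBd_Qstar_pins_len`.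
[cite: Balaban1985BackgroundPropagators, (3.46) p.398 + p.398 (remark after (3.47)), (3.13) p.393, Thm 3.13 p.426; Balaban1984PropagatorsII, Lemma 2.1 (2.60) p.234] -/
theorem blockBd_Q_pins_len (x : MemberY d ℓ hd hL b₀ b₁ Mstar) {bI : FBondY x.toKIdx → IBondY x.toKIdx}
    (hβ1 : ∀ f : FBondY x.toKIdx, (geomT x.D).dist (β x.hN x.D x.hk (bI f)) (blkV1 x.hN x.D f) ≤ 1) {c α₀ : ℝ}
    {U : (bg9Y (Matrix (Fin N) (Fin N) ℂ) (specialUnitaryUnits (Fin N)) x).Cfg}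
    (hU : (bg9Y (Matrix (Fin N) (Fin N) ℂ) (specialUnitaryUnits (Fin N)) x).Reg335 c α₀ U)
    {δ ε : ℝ} (hδ : 0 ≤ δ) (hε : 0 < ε)
    (hM : Real.log (geo9Y x).L ≤ ε * (2 * ((ℓ : ℝ) + 1) ^ 2 - 1) * (geo9Y x).M) (R₀ : ℝ) (H₀ : Prop) :
    BlockBd (g := toB6 (geo9Y x) R₀ H₀) (blkBK x.toKIdx bI) (blkHK x.toKIdx)
      (QcoKH x.toKIdx (trBasis N) (bg9Y (Matrix (Fin N) (Fin N) ℂ) (specialUnitaryUnits (Fin N)) x) (fun U => U) (parBY x.toKIdx) U)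
      (fun y y' => (geo9Y x).L * Real.exp ((δ + ε) * ((ℓ : ℝ) + 4)) *
        (Real.sqrt (((((ℓ + 1 : ℕ) : ℝ) ^ (d + 1)) ^ lvl x.hN x.D x.hk y)⁻¹) * (geo9Y x).len y * ((geo9Y x).len y')⁻¹) *
          Real.exp (-(δ * (geo9Y x).dist y y'))) := by
  have hadj := B9SectDL2Decay.blockBd_of_adjoint (g := toB6 (geo9Y x) R₀ H₀) (blk₁ := blkBK x.toKIdx bI) (blk₂ := blkHK x.toKIdx)
    (fun u F => dotProduct_QcoKH_eq x hU u F) (blockBd_Qstar_pins_len x hβ1 hU hδ hε hM R₀ H₀) (fun y y' =>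
      mul_nonneg (mul_nonneg (mul_nonneg (mul_nonneg (zero_le_one.trans (geo9K_one_le_L x.toKIdx)) (Real.exp_nonneg _))
        (inv_nonneg.mpr (geo9K_len_pos x.toKIdx _).le)) (mul_nonneg (Real.sqrt_nonneg _) (geo9K_len_pos x.toKIdx _).le))
        (Real.exp_nonneg _))
  refine hadj.mono fun y y' => le_of_eq ?_
  change (geo9K x.toKIdx).Site at y y'
  simp only [geo9Y]
  rw [geo9K_dist_comm]
  ring

end Members

end Literature.MathematicalPhysics.QuantumFieldTheory.Balaban1983to89.B9QLettersAtPinsL2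

end
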